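import Mathlib
import Literature.Analysis.FluidPDE.SpaceTimeCalculus
import HarnessLib

/-!
# Shelf crux `EnstrophyQuarterLaw` (stmt-NavierStokesRegularity-1574), line «sparse_sieve»:
# measure-theoretic tools for the dyadic sieve (`stub_sieve`, part 2 of 3)

Theorems helper file (seat ns-hhe-c1 g2; `--supports` the shelf crux). Generic bookkeeping used by
the dyadic ε-regularity sieve proving the registered stub `stub_sieve` of
`Cruxes/EnstrophyQuarterLaw/Lines/sparse_sieve.lean`:

* `lintegral_biUnion_finset_le` — `∫_{⋃_{i∈s} Aᵢ} f ≤ ∑_{i∈s} ∫_{Aᵢ} f` for a finite union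
  (no measurability needed);
* `setLIntegral_Ioo_le_of_le` — a slicewise bound `Φ ≤ c` on `(a,b)` integrates to `c (b − a)`;
* `aemeasurable_setLIntegral_enorm_fderiv_sq` — for a field `u` jointly smooth on `[0,T) × ℝ³`
  the partial dissipation `t ↦ ∫_B ‖D(u t)‖²` over any set `B` is a.e.-measurable on every
  window `(a, b) ⊆ [0, T)` (joint continuity of the slice derivative, tree lemma
  `IsSmoothSpaceTimeOn.continuousOn_fderiv_slice`, and Tonelli
  `AEMeasurable.lintegral_prod_right'`) — the one regularity input that lets a finite sum of
  ball dissipations be integrated term by term in time;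
* `exists_dyadic_level` — the stopping level `J` of the sieve: for `0 < τ ≤ σ R₀²/4` there is `J`
  with `τ ≤ σ (R₀ 2^{-J})² / 4` and `σ (R₀ 2^{-J-1})² / 4 < τ`;
* `sum_range_two_pow_div_le` — the geometric sum `∑_{j ≤ J} 2^j / R₀ ≤ 2 · 2^J / R₀`;
* `window_bound_of_short_windows` — CHOPPING: a bound `K √(b − a)` for all windows of length
  `≤ τ₀` inside `[T₁, T₂]` gives the bound `(⌈(T₂ − T₁)/τ₀⌉₊ + 1) K √(b − a)` for all windows.

HONEST FRAMING: bookkeeping lemmas; nothing here bears on the regularity problem and no summit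
statement is proved.
-/

noncomputable section

-- the summit and its single sub-problem share the name (CONVENTIONS §1), as in every Theorems file
set_option linter.dupNamespace false

namespace Summit.NavierStokesRegularity.NavierStokesRegularity.Theorems.EnstrophyQuarterLaw.SparseSieve

open MeasureTheory Set Metric Finset Filter Topology Function
open Literature.Analysis.FluidPDE
open scoped ENNReal NNReal

/-! ### Finite unions, constant slicewise bounds -/

/-- `∫_{⋃_{i∈s} Aᵢ} f ≤ ∑_{i∈s} ∫_{Aᵢ} f` for a finite family of sets (subadditivity of the
restricted measures; no measurability of `f` or of the sets is needed). [folklore] -/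
theorem lintegral_biUnion_finset_le {ι α : Type*} [MeasurableSpace α] (μ : Measure α)
    (s : Finset ι) (A : ι → Set α) (f : α → ℝ≥0∞) :
    ∫⁻ x in ⋃ i ∈ s, A i, f x ∂μ ≤ ∑ i ∈ s, ∫⁻ x in A i, f x ∂μ := by
  classical
  induction s using Finset.induction_on with
  | empty => simp
  | insert i s hi ih =>
    rw [Finset.set_biUnion_insert, Finset.sum_insert hi]
    exact (lintegral_union_le _ _ _).trans (add_le_add le_rfl ih)

/-- A slicewise bound `Φ t ≤ c` on the window `(a, b)` integrates to `c · (b − a)`. [folklore] -/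
theorem setLIntegral_Ioo_le_of_le {Φ : ℝ → ℝ≥0∞} {a b : ℝ} {c : ℝ≥0∞}
    (h : ∀ t ∈ Ioo a b, Φ t ≤ c) :
    ∫⁻ t in Ioo a b, Φ t ≤ c * ENNReal.ofReal (b - a) := by
  calc ∫⁻ t in Ioo a b, Φ t ≤ ∫⁻ _ in Ioo a b, c := setLIntegral_mono' measurableSet_Ioo h
    _ = c * ENNReal.ofReal (b - a) := by rw [setLIntegral_const, Real.volume_Ioo]

/-! ### Measurability in time of ball dissipations of a jointly smooth field -/

/-- **Time-measurability of partial dissipations.** For a field `u` jointly smooth on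
`[0, T) × ℝ³` (e.g. the velocity of a classical solution below its top time) and any set
`B ⊆ ℝ³`, the partial dissipation `t ↦ ∫_B ‖D(u t)(x)‖² dx` is a.e.-measurable on every window
`(a, b)` with `0 ≤ a`, `b ≤ T`: the slice derivative `(t, x) ↦ D(u t)(x)` is jointly continuous on
the slab (`IsSmoothSpaceTimeOn.continuousOn_fderiv_slice`), hence a.e.-strongly measurable for
`dt|_(a,b) ⊗ dx`, and Tonelli (`AEMeasurable.lintegral_prod_right'`) applies after restricting the
space factor to `B`. [folklore] -/
theorem aemeasurable_setLIntegral_enorm_fderiv_sq {T a b : ℝ}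
    {u : ℝ → EuclideanSpace ℝ (Fin 3) → EuclideanSpace ℝ (Fin 3)}
    (hu : IsSmoothSpaceTimeOn (Ico 0 T) u) (ha : 0 ≤ a) (hb : b ≤ T)
    (B : Set (EuclideanSpace ℝ (Fin 3))) :
    AEMeasurable (fun t => ∫⁻ x in B, ‖fderiv ℝ (u t) x‖ₑ ^ 2)
      ((volume : Measure ℝ).restrict (Ioo a b)) := by
  have hc : ContinuousOn (fun z : ℝ × EuclideanSpace ℝ (Fin 3) => fderiv ℝ (u z.1) z.2)
      (Ioo a b ×ˢ univ) :=
    (hu.continuousOn_fderiv_slice (uniqueDiffOn_Ico 0 T)).mono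
      (prod_mono (fun t ht => ⟨ha.trans ht.1.le, lt_of_lt_of_le ht.2 hb⟩) Subset.rfl)
  have hG : AEStronglyMeasurable (fun z : ℝ × EuclideanSpace ℝ (Fin 3) => fderiv ℝ (u z.1) z.2)
      (((volume : Measure ℝ).restrict (Ioo a b)).prod (volume : Measure (EuclideanSpace ℝ (Fin 3)))) := by
    rw [Measure.restrict_prod_eq_prod_univ]
    exact hc.aestronglyMeasurable (measurableSet_Ioo.prod MeasurableSet.univ)
  have hF : AEMeasurable (fun z : ℝ × EuclideanSpace ℝ (Fin 3) => ‖fderiv ℝ (u z.1) z.2‖ₑ ^ 2)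
      (((volume : Measure ℝ).restrict (Ioo a b)).prod
        ((volume : Measure (EuclideanSpace ℝ (Fin 3))).restrict B)) :=
    (hG.enorm.pow_const 2).mono_measure (Measure.prod_mono le_rfl Measure.restrict_le_self)
  exact hF.lintegral_prod_right'

/-! ### The stopping level and the geometric sum of the sieve -/

/-- **Stopping level.** For `0 < τ ≤ σ R₀² / 4` (`R₀, σ > 0`) there is a dyadic level `J` with
`τ ≤ σ (R₀/2^J)²/4` and `σ (R₀/2^{J+1})²/4 < τ` (the scales `R₀ 2^{-j}` tend to `0`). [folklore] -/
theorem exists_dyadic_level {R₀ σ τ : ℝ} (hR₀ : 0 < R₀) (hσ : 0 < σ) (hτ : 0 < τ)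
    (hτ₀ : τ ≤ σ * R₀ ^ 2 / 4) :
    ∃ J : ℕ, τ ≤ σ * (R₀ / 2 ^ J) ^ 2 / 4 ∧ σ * (R₀ / 2 ^ (J + 1)) ^ 2 / 4 < τ := by
  classical
  have hex : ∃ j : ℕ, σ * (R₀ / 2 ^ (j + 1)) ^ 2 / 4 < τ := by
    obtain ⟨n, hn⟩ := pow_unbounded_of_one_lt (σ * R₀ ^ 2 / (4 * τ)) (by norm_num : (1 : ℝ) < 2)
    refine ⟨n, ?_⟩
    have h2n : (0 : ℝ) < 2 ^ n := by positivity
    have h1 : σ * (R₀ / 2 ^ (n + 1)) ^ 2 / 4 = σ * R₀ ^ 2 / 4 / (2 ^ n * 2 ^ n * 4) := by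
      rw [pow_succ]; field_simp; ring
    rw [h1, div_lt_iff₀ (by positivity)]
    have h3 : σ * R₀ ^ 2 / (4 * τ) * τ = σ * R₀ ^ 2 / 4 := by field_simp
    have h4 : σ * R₀ ^ 2 / 4 < 2 ^ n * τ := by
      have := mul_lt_mul_of_pos_right hn hτ
      rwa [h3] at this
    have h5 : (1 : ℝ) ≤ 2 ^ n := one_le_pow₀ (by norm_num)
    nlinarith
  refine ⟨Nat.find hex, ?_, Nat.find_spec hex⟩
  rcases Nat.eq_zero_or_eq_succ_pred (Nat.find hex) with h0 | hsucc
  · rw [h0]; simpa using hτ₀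
  · have hmin := Nat.find_min hex (m := Nat.find hex - 1) (by omega)
    rw [not_lt] at hmin
    have e : Nat.find hex - 1 + 1 = Nat.find hex := by omega
    rwa [e] at hmin

/-- The geometric sum of the sieve: `∑_{j=0}^{J} 2^j / R₀ ≤ 2 · 2^J / R₀` (`R₀ > 0`). [folklore] -/
theorem sum_range_two_pow_div_le {R₀ : ℝ} (hR₀ : 0 < R₀) (J : ℕ) :
    ∑ j ∈ Finset.range (J + 1), (2 : ℝ) ^ j / R₀ ≤ 2 * 2 ^ J / R₀ := by
  rw [← Finset.sum_div]
  refine div_le_div_of_nonneg_right ?_ hR₀.le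
  have h := geom_sum_eq (x := (2 : ℝ)) (by norm_num) (J + 1)
  rw [h, pow_succ]
  norm_num
  linarith [pow_pos (by norm_num : (0 : ℝ) < 2) J]

/-! ### Chopping long windows -/

/-- **Chopping.** If every window `(a, b) ⊆ [T₁, T₂]` of length `0 < b − a ≤ τ₀` obeys
`∫_a^b Φ ≤ K √(b − a)` (`K ≥ 0`, `τ₀ > 0`), then EVERY window `(a, b) ⊆ [T₁, T₂]` obeys
`∫_a^b Φ ≤ (⌈(T₂ − T₁)/τ₀⌉₊ + 1) K √(b − a)`: cut off pieces of length `τ₀` from the left,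
each costs at most `K √(b − a)`. [folklore] -/
theorem window_bound_of_short_windows {Φ : ℝ → ℝ≥0∞} {T₁ T₂ τ₀ K : ℝ} (hτ₀ : 0 < τ₀) (hK : 0 ≤ K)
    (h : ∀ a b : ℝ, T₁ ≤ a → a < b → b ≤ T₂ → b - a ≤ τ₀ →
      ∫⁻ t in Ioo a b, Φ t ≤ ENNReal.ofReal (K * Real.sqrt (b - a))) :
    ∀ a b : ℝ, T₁ ≤ a → a ≤ b → b ≤ T₂ →
      ∫⁻ t in Ioo a b, Φ t ≤ ENNReal.ofReal ((⌈(T₂ - T₁) / τ₀⌉₊ + 1 : ℕ) * K * Real.sqrt (b - a)) := by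
  -- induction on the number of pieces
  have key : ∀ n : ℕ, ∀ a b : ℝ, T₁ ≤ a → a ≤ b → b ≤ T₂ → b - a ≤ n * τ₀ →
      ∫⁻ t in Ioo a b, Φ t ≤ ENNReal.ofReal (n * K * Real.sqrt (b - a)) := by
    intro n
    induction n with
    | zero =>
      intro a b _ hab _ hlen
      have hba : b = a := le_antisymm (by simpa using hlen) hab
      simp [hba]
    | succ n ih =>
      intro a b ha hab hb hlen
      by_cases hshort : b - a ≤ τ₀
      · rcases eq_or_lt_of_le hab with heq | hlt
        · simp [heq]
        · refine (h a b ha hlt hb hshort).trans (ENNReal.ofReal_le_ofReal ?_)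
          have h1 : (1 : ℝ) ≤ (n + 1 : ℕ) := by exact_mod_cast Nat.succ_le_succ (Nat.zero_le n)
          have h2 : 0 ≤ K * Real.sqrt (b - a) := mul_nonneg hK (Real.sqrt_nonneg _)
          nlinarith
      · rw [not_le] at hshort
        set m : ℝ := a + τ₀ with hm
        have ham : a < m := by rw [hm]; linarith
        have hmb : m < b := by rw [hm]; linarith
        have hsub : Ioo a b ⊆ Ioo a m ∪ Ico m b := fun t ht => by
          rcases lt_or_ge t m with h1 | h1
          · exact Or.inl ⟨ht.1, h1⟩
          · exact Or.inr ⟨h1, ht.2⟩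
        have hIco : ∫⁻ t in Ico m b, Φ t = ∫⁻ t in Ioo m b, Φ t := setLIntegral_congr Ioo_ae_eq_Ico.symm
        have h1 : ∫⁻ t in Ioo a m, Φ t ≤ ENNReal.ofReal (K * Real.sqrt (b - a)) := by
          refine (h a m ha ham (hmb.le.trans hb) (by rw [hm]; linarith)).trans
            (ENNReal.ofReal_le_ofReal (mul_le_mul_of_nonneg_left ?_ hK))
          exact Real.sqrt_le_sqrt (by linarith)
        have h2 : ∫⁻ t in Ioo m b, Φ t ≤ ENNReal.ofReal (n * K * Real.sqrt (b - a)) := by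
          refine (ih m b (ha.trans ham.le) hmb.le hb (by rw [hm]; push_cast at hlen; linarith)).trans
            (ENNReal.ofReal_le_ofReal (mul_le_mul_of_nonneg_left ?_ (by positivity)))
          exact Real.sqrt_le_sqrt (by linarith)
        calc ∫⁻ t in Ioo a b, Φ t ≤ ∫⁻ t in Ioo a m ∪ Ico m b, Φ t := lintegral_mono_set hsub
          _ ≤ (∫⁻ t in Ioo a m, Φ t) + ∫⁻ t in Ico m b, Φ t := lintegral_union_le _ _ _
          _ ≤ ENNReal.ofReal (K * Real.sqrt (b - a)) + ENNReal.ofReal (n * K * Real.sqrt (b - a)) := by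
              rw [hIco]; exact add_le_add h1 h2
          _ = ENNReal.ofReal ((n + 1 : ℕ) * K * Real.sqrt (b - a)) := by
              rw [← ENNReal.ofReal_add (by positivity) (by positivity)]
              congr 1; push_cast; ring
  intro a b ha hab hb
  refine key _ a b ha hab hb ?_
  have hceil : (T₂ - T₁) / τ₀ ≤ (⌈(T₂ - T₁) / τ₀⌉₊ : ℝ) := Nat.le_ceil _
  have h1 : T₂ - T₁ ≤ (⌈(T₂ - T₁) / τ₀⌉₊ : ℝ) * τ₀ := by
    have := mul_le_mul_of_nonneg_right hceil hτ₀.le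
    rwa [div_mul_cancel₀ _ hτ₀.ne'] at this
  push_cast
  nlinarith
end Summit.NavierStokesRegularity.NavierStokesRegularity.Theorems.EnstrophyQuarterLaw.SparseSieve

end
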